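import Summits.ResolutionOfSingularities.ResolutionOfSingularities.Theorems.MarkedTransferCampaignW46MohWindow
import Summits.ResolutionOfSingularities.ResolutionOfSingularities.Theorems.MarkedTransferCampaignW46ForcedRegime
import Literature.AlgebraicGeometry.Resolution.NearPointTauMonotone
import Literature.AlgebraicGeometry.Resolution.NearPointsLocus
import Literature.AlgebraicGeometry.Resolution.GenericPointStalkData
import HarnessLib

/-!
# [OURS · L1 W4.6, rung (iii)] The typed Th. 16.6 procedure terminates in the Moh window on curves — proofs
# (cell res-hironaka, LADDER-RESOLUTION rung L, D-0089; slot W4.6, seat res-L1-s46-pv-5; host route MarkedTransfer,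
# `--supports stmt-ResolutionOfSingularities-16155 --as helper`)

HONEST FRAMING. Nothing here is a statement of H. Hironaka's manuscript (2017-03-23, [Hironaka2017]) and nothing here
asserts that any statement of it holds. These are THEOREMS about the OURS definitions of
`Theorems/MarkedTransferCampaignW46MohWindow.lean` (`MohWindowAt`, `Regime.mohWindowCurve`, the rung predicates
`MohWindowCurveStepDrop` / `MohWindowCurveTerminates` / `MohWindowCurveExitBound`) over the shared typed-procedure
module `Theorems/MarkedTransferCampaignW46TypedProcedure.lean` (res-L1-type-o1) and its companions (anchors;
res-L1-s46-pv-4's `IsCentre.subset_sing`), proved from the tree's blow-up library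
(`Literature/AlgebraicGeometry/Resolution/`: `IsBlowup.exists_reesChart_stalk`, `isRsopPart_chartFamily_reesChart`,
`pow_not_mem_pow_of_not_mem_pow`, `IsBlowup.idealOrder_controlledTransform_eq_of_not_mem_support`, `IsBlowup.isIso_compl`,
`stalkIdeal_vanishingIdeal_eq_maximalIdeal_of_closure_eq`). The typed candidate carriers enter only as the DATA a run
quantifies over (row 001 `IdealExponent.sing` / `transform`, the résumé's Def. 15.12 inclusions through the landed
anchor `IsCentre.isPermissibleCentre`). No FACT-LIST premise is used; no `sorry`; axioms standard. AI review is weaker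
than expert review.

## The argument (what the rung banks about the architecture in regime (iii) on curves)

In `Regime.mohWindowCurve`, `Sing(E)` is a finite set of closed points and `J_ξ = (y^b + u x^d)` (`b < d < 2b`,
`b = E.b`) at each `ξ ∈ Sing(E)`. (1) An admitted centre is closed irreducible inside `Sing(E)`, hence a closed point
`ξ` with `𝓘_{D,ξ} = 𝔪_ξ` (`IsCentre.exists_eq_singleton_of_mohWindowCurve`). (2) KEY LOCAL COMPUTATION
(`MohWindow.idealOrder_controlledTransform_lt`): at every `x′` over `ξ` the transform `J′ = (J𝒪_{Z′} : 𝓘_E^b)` has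
`ord_{x′} J′ < b` — `𝒪_{Z′,x′}` is a localization of a chart `𝒪_ξ[𝔪_ξ/t]`, `t ∈ {x, y}`, regular with `t` a regular
parameter; in the chart `t = x`, `g = x^b (ε^b + u x^{d−b})` and `ε^b + u x^{d−b} ∉ 𝔪_{x′}^b` (at the origin because
`ord(u x^{d−b}) = d − b < b`, order additivity — THIS is where `d < 2b` enters; elsewhere `ε` is a unit); in the
chart `t = y`, `g = y^b (1 + u y^{d−b} ε^d)` with a unit cofactor (`d > b`). (3) Off `ξ` orders do not change and `π`
is injective, so `Sing(E′) ↪ Sing(E) ∖ {ξ}` and `#Sing(E′) < #Sing(E)` (`MohWindowCurveStepDrop`). (4) Every stage of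
a run is singular, so `#Sing(E_k)` cannot decrease forever: `MohWindowCurveTerminates`, with exit bound `#Sing(E₀)`
(`MohWindowCurveExitBound`). Characteristic `p` and perfectness of `K` are not used. Outside the window the argument
is void (K4.6: for `y^p + xⁿ`, `n > 2p`, the x-chart origin stays singular with the same germ type) — nothing is
claimed there.

## References

* `Theorems/MarkedTransferCampaignW46MohWindow.lean` (statements), `…TypedProcedure.lean` / `…Anchors.lean` (res-L1-type-o1),
  `…ForcedRegime.lean` (res-L1-s46-pv-4); L/res-L0-k46/KILL-TEST-K4.6.md §4 (kit job j258573, ALIVE, `B(p) = 2p`).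
* V. Cossart, O. Piltant, J. Algebra 320 (2008), proof of Prop. 4.2 (charts of a point blow-up, weak transform) — the
  tree files cited above carry the locators. [CossartPiltant2008]
* H. Hironaka, ms. 2017-03-23, Th. 16.6 p.84 l.4–20, Th. 16.13 p.87 l.26–28, Def. 2.1 p.5 l.2–3 — scope only, under
  adjudication, not cited as fact. [Hironaka2017]
-/

noncomputable section

set_option linter.dupNamespace false -- mandated namespace of this single-conjunct summit

open CategoryTheory AlgebraicGeometry TopologicalSpace IsLocalRing

namespace Summit.ResolutionOfSingularities.ResolutionOfSingularities.Theorems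

namespace CampaignW46

open Literature.AlgebraicGeometry.Resolution
open Literature.AlgebraicGeometry.Hironaka2017.S02Preliminaries
open Literature.AlgebraicGeometry.Hironaka2017.Datum
open Scheme.IdealSheafData

universe u

namespace MohWindow

/-! ## Ring level -/

/-- `Set.range ![x, y] = {x, y}`. [folklore] -/
theorem range_vec2 {α : Type u} (x y : α) : Set.range ![x, y] = {x, y} := by
  ext r
  simp only [Set.mem_range, Set.mem_insert_iff, Set.mem_singleton_iff]
  constructor
  · rintro ⟨i, rfl⟩
    fin_cases i
    exacts [Or.inl rfl, Or.inr rfl]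
  · rintro (rfl | rfl)
    exacts [⟨0, rfl⟩, ⟨1, rfl⟩]

/-- A window exponent is positive (`b < d < 2b` forces `0 < b`). [folklore] -/
theorem pos_of_mohWindowAt {b : ℕ} {S : Type u} [CommRing S] [IsLocalRing S] {I : Ideal S}
    (h : MohWindowAt b S I) : 0 < b := by
  obtain ⟨-, -, -, -, -, d, -, -, hbd, hd2, -⟩ := h
  omega

section Ring

variable {R : Type u} [CommRing R] [IsRegularLocalRing R]

/-- In the chart `D₊(c_j t)` of the blow-up of the closed point of a `2`-dimensional regular local ring `R` with regular
system of parameters `c = (c₀, c₁)`, at a prime `𝔴` over `𝔪_R` with local ring `L = (B_j)_𝔴`: `L` is regular and the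
exceptional parameter `c_j` is a regular parameter of `L` (`c_j ∈ 𝔪_L ∖ 𝔪_L²`) — the case `a = l = 0` of the tree's
`isRsopPart_chartFamily_reesChart`. [cite: CossartPiltant2008, proof of Prop. 4.2] -/
theorem chart_isRegularLocalRing_and_not_mem_sq (hd : (maximalIdeal R).spanFinrank = 2)
    (c : Fin 2 → R) (hc : Ideal.span (Set.range c) = maximalIdeal R) (j : Fin 2)
    (𝔴 : Ideal (chartRing c j)) [𝔴.IsPrime] (h𝔴 : 𝔴.comap (chartBase c j) = maximalIdeal R)
    (L : Type u) [CommRing L] [IsLocalRing L] [Algebra (chartRing c j) L] [IsLocalization.AtPrime L 𝔴] :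
    IsRegularLocalRing L ∧
      (algebraMap (chartRing c j) L : chartRing c j →+* L) (chartBase c j (c j)) ∈ maximalIdeal L ∧
      (algebraMap (chartRing c j) L : chartRing c j →+* L) (chartBase c j (c j)) ∉ maximalIdeal L ^ 2 := by
  classical
  have hz : Ideal.span (Set.range (Fin.append c (fun k : Fin 0 => Fin.elim0 k))) = maximalIdeal R := by
    rw [← hc]
    congr 1
    ext r
    constructor
    · rintro ⟨i, rfl⟩
      refine Fin.addCases (fun k => ⟨k, ?_⟩) (fun k => Fin.elim0 k) i
      rw [Fin.append_left]
    · rintro ⟨k, rfl⟩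
      exact ⟨Fin.castAdd 0 k, by rw [Fin.append_left]⟩
  have hrsop := isRsopPart_chartFamily_reesChart c j (fun k : Fin 0 => Fin.elim0 k) hz
    (by rw [hd]) 𝔴 h𝔴 L (a := 0) (fun k : Fin 0 => Fin.elim0 k)
    (Function.injective_of_subsingleton _) (fun k => Fin.elim0 k)
  refine ⟨hrsop.isRegularLocalRing, ?_, ?_⟩
  · have h0 := hrsop.mem_maximalIdeal 0
    simpa only [chartFamily, Fin.cons_zero] using h0
  · have h0 := hrsop.not_mem_sq 0
    simpa only [chartFamily, Fin.cons_zero] using h0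

omit [IsRegularLocalRing R] in
/-- Colon bookkeeping: if `ψ g = t^μ · G` and `g ∈ J`, then `G ∈ (ψ(J) S : (t)^μ)`. [folklore] -/
theorem mem_colon_of_map_eq_pow_mul {S : Type*} [CommRing S] (ψ : R →+* S) {t G : S} {g : R} {μ : ℕ}
    (h : ψ g = t ^ μ * G) {Jx : Ideal R} (hg : g ∈ Jx) :
    G ∈ Submodule.colon (Jx.map ψ) ((Ideal.span {t} ^ μ : Ideal S) : Set S) := by
  rw [Submodule.mem_colon]
  intro s hs
  rw [Ideal.span_singleton_pow, SetLike.mem_coe] at hs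
  obtain ⟨r, rfl⟩ := Ideal.mem_span_singleton'.mp hs
  have : G * (r * t ^ μ) = r * ψ g := by
    rw [h]
    ring
  rw [smul_eq_mul, this]
  exact Ideal.mul_mem_left _ r (Ideal.mem_map_of_mem _ hg)

end Ring

/-- **Key computation** (local algebra in a regular local ring `L`, the local ring of the blown-up surface at a point
over the centre): `t` a regular parameter of `L` (the exceptional one), `v` a unit, `1 ≤ m`, `m + 1 ≤ b`. Then
neither `ε^b + v t^m` (the weak transform in the chart `t = x`: order `m < b` at the origin `ε ∈ 𝔪_L`, a unit
elsewhere) nor `1 + v t^m ε^{b+m}` (the weak transform in the chart `t = y`: a unit) lies in `𝔪_L^b`. Uses order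
additivity in regular local rings (`pow_not_mem_pow_of_not_mem_pow`). [folklore] -/
theorem weakTransform_not_mem_pow {L : Type u} [CommRing L] [IsRegularLocalRing L] {t ε v : L} {b m : ℕ}
    (ht1 : t ∈ maximalIdeal L) (ht2 : t ∉ maximalIdeal L ^ 2) (hv : IsUnit v) (hm1 : 1 ≤ m)
    (hmb : m + 1 ≤ b) :
    ε ^ b + v * t ^ m ∉ maximalIdeal L ^ b ∧ 1 + v * (t ^ m * ε ^ (b + m)) ∉ maximalIdeal L ^ b := by
  have htm : v * t ^ m ∈ maximalIdeal L := Ideal.mul_mem_left _ _ (Ideal.pow_mem_of_mem _ ht1 m hm1)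
  constructor
  · intro hmem
    by_cases he : ε ∈ maximalIdeal L
    · -- origin: `ord (v t^m) = m < b`
      have h1 : ε ^ b ∈ maximalIdeal L ^ b := Ideal.pow_mem_pow he b
      have h2 : v * t ^ m ∈ maximalIdeal L ^ b := by
        have := sub_mem hmem h1
        rwa [add_sub_cancel_left] at this
      have h3 : t ^ m ∈ maximalIdeal L ^ b := (Ideal.unit_mul_mem_iff_mem _ hv).mp h2
      have h4 : t ^ m ∉ maximalIdeal L ^ (m * 1 + 1) := pow_not_mem_pow_of_not_mem_pow ht2 m
      exact h4 (Ideal.pow_le_pow_right (by omega) h3)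
    · -- off the origin: `ε` is a unit, `g′ ≡ ε^b (mod 𝔪)`
      have h1 : ε ^ b ∈ maximalIdeal L := by
        have hmem' : ε ^ b + v * t ^ m ∈ maximalIdeal L := Ideal.pow_le_self (by omega) hmem
        have := sub_mem hmem' htm
        rwa [add_sub_cancel_right] at this
      exact he ((Ideal.IsPrime.mem_of_pow_mem inferInstance b h1))
  · intro hmem
    have hmem' : 1 + v * (t ^ m * ε ^ (b + m)) ∈ maximalIdeal L := Ideal.pow_le_self (by omega) hmem
    have h2 : v * (t ^ m * ε ^ (b + m)) ∈ maximalIdeal L :=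
      Ideal.mul_mem_left _ _ (Ideal.mul_mem_right _ _ (Ideal.pow_mem_of_mem _ ht1 m hm1))
    have h1 : (1 : L) ∈ maximalIdeal L := by
      have := sub_mem hmem' h2
      rwa [add_sub_cancel_right] at this
    exact (maximalIdeal.isMaximal L).ne_top ((Ideal.eq_top_iff_one _).mpr h1)

/-! ## Scheme level: no singular point of the transform over a window point -/

section Local

variable {X X' : Scheme.{u}} {π : X' ⟶ X}

/-- **Over a Moh-window point the transform has order `< b` everywhere.** Let `π : X′ → X` be a blow-up along the
ideal of a closed `Y` whose stalk at `π x′` is the maximal ideal, and let `J` be a window germ of exponent `b` at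
`π x′` (`MohWindowAt`). Then `ord_{x′} J′ < b` for the controlled (here = weak = strict) transform
`J′ = (J𝒪_{X′} : 𝓘_E^b)`. [cite: CossartPiltant2008, proof of Prop. 4.2] -/
theorem idealOrder_controlledTransform_lt [IsLocallyNoetherian X'] {Y : Closeds X}
    (hπ : IsBlowup π (vanishingIdeal Y)) {J : X.IdealSheafData} {b : ℕ} {x' : X'}
    (hY : stalkIdeal (vanishingIdeal Y) (π x') = maximalIdeal (X.presheaf.stalk (π x')))
    (hW : MohWindowAt b (X.presheaf.stalk (π x')) (stalkIdeal J (π x'))) :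
    idealOrder (controlledTransform π (vanishingIdeal Y) J b) x' < b := by
  classical
  obtain ⟨hreg, hdim, x, y, hxy, d, u, hu, hbd, hd2, hJ⟩ := hW
  haveI := hreg
  obtain ⟨m, rfl⟩ : ∃ m, d = b + m := Nat.exists_eq_add_of_le hbd.le
  have hm1 : 1 ≤ m := by omega
  have hmb : m + 1 ≤ b := by omega
  set c : Fin 2 → X.presheaf.stalk (π x') := ![x, y] with hc_def
  have hc : Ideal.span (Set.range c) = maximalIdeal _ := by rw [hc_def, range_vec2]; exact hxy
  have hcY : Ideal.span (Set.range c) = stalkIdeal (vanishingIdeal Y) (π x') := hc.trans hY.symm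
  obtain ⟨j, 𝔴, χ, hχ, hloc, h𝔴⟩ := hπ.exists_reesChart_stalk x' c hcY
  letI := χ.toAlgebra
  haveI : IsLocalization.AtPrime (X'.presheaf.stalk x') 𝔴.asIdeal := hloc
  have halg : ∀ w, (algebraMap (chartRing c j) (X'.presheaf.stalk x') :
      chartRing c j →+* X'.presheaf.stalk x') w = χ w := fun _ => rfl
  -- the local ring at `x'` is regular, the exceptional parameter `t = c_j` is a regular parameter there
  obtain ⟨hLreg, ht1, ht2⟩ :=
    chart_isRegularLocalRing_and_not_mem_sq hdim c hc j 𝔴.asIdeal h𝔴 (X'.presheaf.stalk x')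
  haveI := hLreg
  rw [halg, hχ] at ht1 ht2
  -- notation: `ψ = π^♯_{x′}`; the chart relations `ψ c_i = ψ c_j · ε_i`
  set ψ : X.presheaf.stalk (π x') →+* X'.presheaf.stalk x' := (π.stalkMap x').hom with hψ
  have hrel : ∀ i, ψ (c i) = ψ (c j) * χ (chartGen c j i) := stalkMap_apply_eq_mul_chartGen j χ hχ
  have hv : IsUnit (ψ u) := hu.map ψ
  obtain ⟨hG0, hG1⟩ := weakTransform_not_mem_pow (ε := χ (chartGen c j (if j = 0 then 1 else 0)))
    ht1 ht2 hv hm1 hmb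
  -- `g = y^b + u x^{b+m} ∈ J_{π x'}` and its weak transform `G` at `x′`: `ψ g = (ψ c_j)^b · G`, `G ∉ 𝔪^b`
  have hgJ : c 1 ^ b + u * c 0 ^ (b + m) ∈ stalkIdeal J (π x') := by
    rw [hJ]
    exact Ideal.mem_span_singleton_self _
  obtain ⟨G, hG, hGnot⟩ : ∃ G : X'.presheaf.stalk x',
      ψ (c 1 ^ b + u * c 0 ^ (b + m)) = ψ (c j) ^ b * G ∧ G ∉ maximalIdeal (X'.presheaf.stalk x') ^ b := by
    obtain rfl | rfl : j = 0 ∨ j = 1 := Fin.exists_fin_two.mp ⟨j, rfl⟩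
    · refine ⟨χ (chartGen c 0 1) ^ b + ψ u * ψ (c 0) ^ m, ?_, by simpa using hG0⟩
      rw [map_add, map_mul, map_pow, map_pow, hrel 1]
      ring
    · refine ⟨1 + ψ u * (ψ (c 1) ^ m * χ (chartGen c 1 0) ^ (b + m)), ?_, by simpa using hG1⟩
      rw [map_add, map_mul, map_pow, map_pow, hrel 0]
      ring
  -- `G ∈ J′_{x′}`
  have hCmap : (stalkIdeal (vanishingIdeal Y) (π x')).map ψ = Ideal.span {ψ (c j)} := by
    rw [← hcY, Ideal.map_span_range_eq_span_singleton _ c j _ hrel]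
  have hmem : G ∈ stalkIdeal (controlledTransform π (vanishingIdeal Y) J b) x' := by
    rw [controlledTransform, stalkIdeal_colon, stalkIdeal_pow, stalkIdeal_comap_eq_map_stalkMap,
      stalkIdeal_comap_eq_map_stalkMap, ← hψ, hCmap]
    exact mem_colon_of_map_eq_pow_mul ψ hG hgJ
  -- conclude: `J′_{x′} ⊄ 𝔪^b`
  by_contra hle
  rw [not_lt, le_idealOrder_iff] at hle
  exact hGnot (hle hmem)

/-- Off a closed centre a blow-up along its (reduced) ideal is injective — it is an isomorphism, in particular an
open embedding, over the complement (`IsBlowup.isIso_compl`). [cite: StacksProject, Tag 02OS] -/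
theorem injOn_preimage_compl {Y : Closeds X} (hπ : IsBlowup π (vanishingIdeal Y)) :
    Set.InjOn π.base (π.base ⁻¹' (Y : Set X)ᶜ) := by
  let U : X.Opens := ⟨((vanishingIdeal Y).support : Set X)ᶜ, (vanishingIdeal Y).support.isClosed.isOpen_compl⟩
  haveI : IsIso (π ∣_ U) := hπ.isIso_compl
  have hUeq : (U : Set X) = (Y : Set X)ᶜ := by
    show ((vanishingIdeal Y).support : Set X)ᶜ = _
    rw [coe_support_vanishingIdeal]
  intro a ha b hb hab
  have ha' : a ∈ π ⁻¹ᵁ U := show π.base a ∈ (U : Set X) by rw [hUeq]; exact ha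
  have hb' : b ∈ π ⁻¹ᵁ U := show π.base b ∈ (U : Set X) by rw [hUeq]; exact hb
  have heq : (π ∣_ U) ⟨a, ha'⟩ = (π ∣_ U) ⟨b, hb'⟩ := by
    apply Subtype.ext
    rw [morphismRestrict_base_coe, morphismRestrict_base_coe]
    exact hab
  exact congrArg Subtype.val ((π ∣_ U).isOpenEmbedding.injective heq)

end Local

end MohWindow

/-! ## The rung: proofs -/

section Proof

variable {n : ℕ} {p : ℕ} [Fact p.Prime] {K : Type u} [Field K] [CharP K p]
variable {N : Notions.{u} n} {A A' : AmbientDatum p K} {E : IdealExponent A.Z} {R : Resume N A E}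

/-- In the regime, a centre admitted by the typed Th. 16.6 rule is a single closed point of `Sing(E)`: it is closed
irreducible inside the finite set of closed points `Sing(E)`, so it is the closure of its (closed) generic point.
[folklore] -/
theorem IsCentre.exists_eq_singleton_of_mohWindowCurve {D : Closeds A.Z} (hD : IsCentre R D)
    (hRg : Regime.mohWindowCurve A E) :
    ∃ ξ : A.Z, ξ ∈ E.sing ∧ IsClosed ({ξ} : Set A.Z) ∧ (D : Set A.Z) = {ξ} := by
  obtain ⟨-, hcl, -⟩ := hRg
  have hirr := hD.irreducible
  have hgen : IsGenericPoint hirr.genericPoint (D : Set A.Z) :=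
    hirr.isGenericPoint_genericPoint D.isClosed
  have hηS : hirr.genericPoint ∈ E.sing := hD.subset_sing hgen.mem
  have hηcl : IsClosed ({hirr.genericPoint} : Set A.Z) := hcl hηS
  exact ⟨hirr.genericPoint, hηS, hηcl, hgen.def.symm.trans hηcl.closure_eq⟩

/-- [OURS · L1 W4.6 rung (iii); NOT a statement of the manuscript] **One step in the window strictly shrinks the
singular locus.** For a state `(A, E, R)` in `Regime.mohWindowCurve` and a step `s` admitted by the typed centre rule
(the blow-up of a closed point `ξ ∈ Sing(E)`), `Sing(E′)` maps injectively into `Sing(E) ∖ {ξ}` — no point over `ξ`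
is singular for `E′` (`MohWindow.idealOrder_controlledTransform_lt`), off `ξ` orders do not change and `π` is
injective — hence `#Sing(E′) < #Sing(E)`. [folklore] -/
theorem Step.sing_ncard_lt_of_mohWindowCurve (s : Step R A') (hRg : Regime.mohWindowCurve A E) :
    s.E'.sing.ncard < E.sing.ncard := by
  classical
  obtain ⟨ξ, hξS, hξcl, hDξ⟩ := s.centre.exists_eq_singleton_of_mohWindowCurve hRg
  obtain ⟨hfin, -, hwin⟩ := hRg
  haveI : IsLocallyNoetherian A'.Z := by
    haveI := A'.smooth
    exact LocallyOfFiniteType.isLocallyNoetherian A'.hom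
  have hπ : IsBlowup s.π (vanishingIdeal s.D) := s.blowup
  -- the singular points of `E′` lie over `Sing(E) ∖ {ξ}`
  have hmaps : ∀ x' ∈ s.E'.sing, s.π.base x' ∈ E.sing \ {ξ} := by
    intro x' hx'
    have hx'b : (E.b : ℕ∞) ≤ idealOrder (controlledTransform s.π (vanishingIdeal s.D) E.J E.b) x' := hx'
    have hne : s.π.base x' ≠ ξ := by
      intro heq
      have hY : stalkIdeal (vanishingIdeal s.D) (s.π.base x') =
          maximalIdeal (A.Z.presheaf.stalk (s.π.base x')) := by
        apply stalkIdeal_vanishingIdeal_eq_maximalIdeal_of_closure_eq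
        rw [hDξ, heq, hξcl.closure_eq]
      have hW : MohWindowAt E.b (A.Z.presheaf.stalk (s.π.base x')) (stalkIdeal E.J (s.π.base x')) :=
        hwin _ (heq ▸ hξS)
      have hlt := MohWindow.idealOrder_controlledTransform_lt hπ hY hW
      exact (not_le.mpr hlt) hx'b
    have hnot : s.π.base x' ∉ (vanishingIdeal s.D).support := by
      rw [← SetLike.mem_coe, coe_support_vanishingIdeal, hDξ]
      exact hne
    refine ⟨?_, hne⟩
    show (E.b : ℕ∞) ≤ idealOrder E.J (s.π.base x')
    rw [← hπ.idealOrder_controlledTransform_eq_of_not_mem_support E.J E.b hnot]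
    exact hx'b
  have hinj : Set.InjOn s.π.base s.E'.sing := by
    refine (MohWindow.injOn_preimage_compl hπ).mono fun x' hx' => ?_
    show s.π.base x' ∈ (s.D : Set A.Z)ᶜ
    rw [hDξ]
    exact (hmaps x' hx').2
  have hle : s.E'.sing.ncard ≤ (E.sing \ {ξ}).ncard :=
    Set.ncard_le_ncard_of_injOn s.π.base hmaps hinj (hfin.subset fun _ hx => hx.1)
  have hdiff : (E.sing \ {ξ}).ncard = E.sing.ncard - 1 := Set.ncard_sdiff_singleton_of_mem hξS
  have hpos : 0 < E.sing.ncard := (Set.ncard_pos hfin).mpr ⟨ξ, hξS⟩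
  omega

/-- [OURS · L1 W4.6 rung (iii); NOT a statement of the manuscript] **The typed Th. 16.6 procedure terminates in the
Moh window on curves**, for every notion instance and every reading: along a run all of whose stages lie in the
regime the natural number `#Sing(E_k)` would strictly decrease forever. [folklore] -/
theorem terminates_mohWindowCurve (N : Notions.{u} n) (Rd : Reading p K N) :
    Terminates N Rd (Regime.mohWindowCurve (p := p) (K := K)) := by
  intro r hr
  have hlt : ∀ k, (r.E (k + 1)).sing.ncard < (r.E k).sing.ncard := fun k => by
    rw [r.E_succ k]
    exact (r.step k).sing_ncard_lt_of_mohWindowCurve (hr k)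
  have hmono : ∀ k, (r.E k).sing.ncard + k ≤ (r.E 0).sing.ncard := by
    intro k
    induction k with
    | zero => simp
    | succ k ih => have := hlt k; omega
  have := hmono ((r.E 0).sing.ncard + 1)
  omega

/-- [OURS · L1 W4.6 rung (iii); NOT a statement of the manuscript] **Exit bound**: every run of the typed procedure
(any `N`, any `Rd`) has a stage `k ≤ #Sing(E₀)` outside the regime — while the stages `0, …, k` lie in the regime,
`#Sing(E_k) + k ≤ #Sing(E₀)` and `#Sing(E_k) ≥ 1` (every stage of a run is singular, `Run.sing_nonempty`). [folklore] -/
theorem Run.exists_exit_le_ncard_of_mohWindowCurve {Rd : Reading p K N} (r : Run N Rd) :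
    ∃ k ≤ (r.E 0).sing.ncard, ¬ Regime.mohWindowCurve (p := p) (K := K) (r.A k) (r.E k) := by
  by_contra h
  simp only [not_exists, not_and, not_not] at h
  have hmono : ∀ k, k ≤ (r.E 0).sing.ncard → (r.E k).sing.ncard + k ≤ (r.E 0).sing.ncard := by
    intro k
    induction k with
    | zero => intro _; simp
    | succ k ih =>
      intro hk
      have hlt : (r.E (k + 1)).sing.ncard < (r.E k).sing.ncard := by
        rw [r.E_succ k]
        exact (r.step k).sing_ncard_lt_of_mohWindowCurve (h k (by omega))
      have := ih (by omega)
      omega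
  set k₀ := (r.E 0).sing.ncard with hk₀
  have hk : (r.E k₀).sing.ncard + k₀ ≤ k₀ := hmono k₀ le_rfl
  have hfin : (r.E k₀).sing.Finite := (h k₀ le_rfl).1
  have hpos : 0 < (r.E k₀).sing.ncard := (Set.ncard_pos hfin).mpr (r.sing_nonempty k₀)
  omega

/-- [OURS · L1 W4.6 rung (iii)] **`MohWindowCurveStepDrop` holds** (every `p`, `K`). [folklore] -/
theorem mohWindowCurveStepDrop_holds (p : ℕ) [Fact p.Prime] (K : Type u) [Field K] [CharP K p] :
    MohWindowCurveStepDrop p K :=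
  fun _ _ _ _ _ _ s hRg => s.sing_ncard_lt_of_mohWindowCurve hRg

/-- [OURS · L1 W4.6 rung (iii)] **The rung `MohWindowCurveTerminates` holds** (every `p`, `K`). [folklore] -/
theorem mohWindowCurveTerminates_holds (p : ℕ) [Fact p.Prime] (K : Type u) [Field K] [CharP K p] :
    MohWindowCurveTerminates p K :=
  fun _ N Rd => terminates_mohWindowCurve N Rd

/-- [OURS · L1 W4.6 rung (iii)] **`MohWindowCurveExitBound` holds** (every `p`, `K`). [folklore] -/
theorem mohWindowCurveExitBound_holds (p : ℕ) [Fact p.Prime] (K : Type u) [Field K] [CharP K p] :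
    MohWindowCurveExitBound p K :=
  fun _ _ _ r => r.exists_exit_le_ncard_of_mohWindowCurve

end Proof

end CampaignW46

end Summit.ResolutionOfSingularities.ResolutionOfSingularities.Theorems

end
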